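import Summits.QuantumFields.YangMills.Theorems.UnitScaleGibbsChartPairingDictionary
import Summits.QuantumFields.YangMills.Theorems.UnitScaleGibbsBlockPlaquetteLinWeightDecay
import HarnessLib

/-!
# `GrossTransferStubLinTestWeightReadoutRows` — STEP-0 ROWS OF THE KNIT-E2 SKELETON: THE ANTISYMMETRISED `linWeight` READ-OUT `wt` HAS
# `M₀ = Σ_μΣ_νΣ_{Q_{R₀}(z₀)} |wt| ≤ 2·(L²)^j` AND `Σ_{Q_{R₀}(z₀)}Σ_μΣ_ν wt² ≤ 2·(L²∕L^d)^j·(L²)^j`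
# (LINE 28 «GrossTransfer»; crux `UnitScaleTilt.HistoryTailL` stmt-QuantumFields-19936 ∕ `MeanDeviationL` stmt-QuantumFields-23083)

Cell `ym3-torus` (YM ladder rung R3 = continuum SU(2) Yang–Mills on every three-torus — a RUNG, NOT d = 4, NOT infinite volume, NOT a mass gap, NOT the
Clay problem); width seat `ym-ust-19936-w5` gen 17.  The pen's KNIT-E2 skeleton (★w2-19936 g15's HOME workfile `GrossTransferStubLinTestPointwisePackage`
v2.x — NOT the registered `Lines/gross_transfer.lean`, which has no `wt`) reads
the averaging weights `linWeight j a` ON `ℤ^d` through the free symbol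
`wt y μ ν := if y ∈ box z₀ R₀ then (if μ < ν then linWeight j a ⟨castSite y, μ, ν⟩ else if ν < μ then −linWeight j a ⟨castSite y, ν, μ⟩ else 0) else 0`
(hypothesis `hwt`), and every KNIT-D ∕ COLLAR row it calls is priced in `M₀ := Σ_μΣ_ν'Σ_{y∈Q_{R₀}(z₀)}|wt y μ ν'|` (✓`UnitScaleGibbsTruncatedPotentialEnergyMass`)
and `Σ_{y∈Q_{R₀}(z₀)}Σ_μΣ_ν wt y μ ν²` (its energy row).  STEP 0 of the skeleton (the constant `C`) needs both in powers of `L^j`.  THIS FILE (def-free,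
generic `P`, `j`, `a`, `z₀`, `R₀` with the chart box NON-WRAPPING `2R₀ < sitesPerDir 0`):
* letters from `hwt`: `readout_of_not_mem`, `readout_of_lt`, `readout_of_gt`, `readout_diag`, ★`readout_antisymm`;
* ★`sum_sum_abs_readout_eq` ∕ ★`sum_sum_sq_readout_eq`: at `y ∈ Q_{R₀}(z₀)`, `Σ_μΣ_ν |wt y μ ν| = 2·Σ_{μ<ν} linWeight j a ⟨castSite y,μ,ν⟩` and
  `Σ_μΣ_ν wt y μ ν² = 2·Σ_{μ<ν} (linWeight j a ⟨castSite y,μ,ν⟩)²` (E2a ✓`sum_sum_eq_two_mul_sum_lt` with the orientation-sign array);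
* ★`sum_box_lt_le_sum_plaq`: `Σ_{y∈Q_{R₀}(z₀)}Σ_{μ<ν} G⟨castSite y,μ,ν⟩ ≤ Σ_{p : Plaq P 0} G p` for `G ≥ 0` (injectivity of `castSite` on the non-wrapping box);
* ★★★`readout_abs_sum_le : M₀ ≤ 2·(L·L)^j` (✓`sum_linWeight`, ✓`linWeight_nonneg`) and ★★★`readout_sq_sum_le : Σ_{Q_{R₀}}ΣΣ wt² ≤ 2·(L²∕L^d)^j·(L²)^j`
  (✓`sum_linWeight_sq_le`, `j ≤ m + K`).
HONEST SCOPE.  Finite-sum bookkeeping for the pen's STEP 0; proves no stub and closes no item.  Nothing of `main_estimate`, `stub_linTest`, «ShallowFluxSecondMomentL»,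
(Q), 23083∕23133∕23134, K1, `stub_pinnedStep`∕`stub_unitEnvelope` or `HistoryTailL` is proved.  YM₃ on T³ is rung R3 — NOT d = 4, NOT a mass gap, NOT Clay.
References: T. Bałaban, CMP **109** (1987) 249–301, (0.1)∕(0.3) pp. 251–252 [Balaban1987RG1]; CMP **98** (1985) 17–51, (48) p. 26 [Balaban1985Averaging];
CMP **99** (1985) 389–434, (3.100) p. 413 [Balaban1985BackgroundPropagators].
-/

set_option autoImplicit false

noncomputable section

open scoped BigOperators
open Finset
open Literature.MathematicalPhysics.QuantumFieldTheory.Balaban1983to89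
open Literature.MathematicalPhysics.QuantumFieldTheory.Balaban1983to89.B4Eq19LatticeOperators (Zd unitVec box mem_box)
open Literature.MathematicalPhysics.QuantumFieldTheory.Balaban1983to89.T4AxialGaugeSmallField (castSite castSite_injOn_box)
open Summit.QuantumFields.YangMills.Theorems.UnitScaleGibbsBlockPlaquetteLinWeight (linWeight sum_linWeight linWeight_nonneg
  sum_linWeight_sq_le)
open Summit.QuantumFields.YangMills.Theorems.UnitScaleGibbsChartPairingDictionary (sum_sum_eq_two_mul_sum_lt)

namespace Summit.QuantumFields.YangMills.Theorems.GrossTransferStubLinTestWeightReadoutRows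

variable {P : Params} {j : ℕ} (a : Plaq P j) (z₀ : Zd P.d) (R₀ : ℕ) (wt : Zd P.d → Fin P.d → Fin P.d → ℝ)
  (hwt : ∀ y μ ν, wt y μ ν =
    if y ∈ box z₀ (R₀ : ℤ) then
      (if h : μ < ν then linWeight j a ⟨castSite y, μ, ν, h⟩ else if h' : ν < μ then -linWeight j a ⟨castSite y, ν, μ, h'⟩ else 0)
    else 0)

/-! ## §1 Letters of the read-out -/

include hwt in
/-- Off the chart box the read-out vanishes. [folklore] -/
theorem readout_of_not_mem {y : Zd P.d} (hy : y ∉ box z₀ (R₀ : ℤ)) (μ ν : Fin P.d) : wt y μ ν = 0 := by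
  rw [hwt, if_neg hy]

include hwt in
/-- On the chart box, for `μ < ν`, the read-out is the weight of the plaquette `⟨castSite y, μ, ν⟩`. [cite: Balaban1985BackgroundPropagators, (3.100) p.413] -/
theorem readout_of_lt {y : Zd P.d} (hy : y ∈ box z₀ (R₀ : ℤ)) {μ ν : Fin P.d} (h : μ < ν) :
    wt y μ ν = linWeight j a ⟨castSite y, μ, ν, h⟩ := by
  rw [hwt, if_pos hy, dif_pos h]

include hwt in
/-- On the chart box, for `ν < μ`, the read-out is minus the weight of `⟨castSite y, ν, μ⟩`. [cite: Balaban1985BackgroundPropagators, (3.100) p.413] -/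
theorem readout_of_gt {y : Zd P.d} (hy : y ∈ box z₀ (R₀ : ℤ)) {μ ν : Fin P.d} (h : ν < μ) :
    wt y μ ν = -linWeight j a ⟨castSite y, ν, μ, h⟩ := by
  rw [hwt, if_pos hy, dif_neg (not_lt.2 h.le), dif_pos h]

include hwt in
/-- The diagonal of the read-out vanishes. [folklore] -/
theorem readout_diag (y : Zd P.d) (μ : Fin P.d) : wt y μ μ = 0 := by
  by_cases hy : y ∈ box z₀ (R₀ : ℤ)
  · rw [hwt, if_pos hy, dif_neg (lt_irrefl _), dif_neg (lt_irrefl _)]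
  · rw [hwt, if_neg hy]

include hwt in
/-- ★ The read-out is antisymmetric: `wt y ν μ = −wt y μ ν`. [folklore] -/
theorem readout_antisymm (y : Zd P.d) (μ ν : Fin P.d) : wt y ν μ = -wt y μ ν := by
  by_cases hy : y ∈ box z₀ (R₀ : ℤ)
  · rcases lt_trichotomy μ ν with h | h | h
    · rw [readout_of_gt a z₀ R₀ wt hwt hy h, readout_of_lt a z₀ R₀ wt hwt hy h]
    · subst h; rw [readout_diag a z₀ R₀ wt hwt, neg_zero]
    · rw [readout_of_lt a z₀ R₀ wt hwt hy h, readout_of_gt a z₀ R₀ wt hwt hy h, neg_neg]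
  · rw [readout_of_not_mem a z₀ R₀ wt hwt hy, readout_of_not_mem a z₀ R₀ wt hwt hy, neg_zero]

/-! ## §2 The ordered double sums at a chart point -/

/-- The ORIENTATION SIGN array `s μ ν = [μ<ν] − [ν<μ]` is antisymmetric. [folklore] -/
theorem sign_antisymm (μ ν : Fin P.d) :
    (if ν < μ then (1 : ℝ) else if μ < ν then -1 else 0) = -(if μ < ν then (1 : ℝ) else if ν < μ then -1 else 0) := by
  rcases lt_trichotomy μ ν with h | h | h
  · rw [if_neg (not_lt.2 h.le), if_pos h, if_pos h]
  · subst h; simp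
  · rw [if_pos h, if_neg (not_lt.2 h.le), if_pos h, neg_neg]

include hwt in
/-- ★ **`Σ_μΣ_ν |wt y μ ν| = 2·Σ_{μ<ν} linWeight j a ⟨castSite y, μ, ν⟩`** at a chart point `y ∈ Q_{R₀}(z₀)` (`|wt| = wt · sign`, then E2a's
✓`sum_sum_eq_two_mul_sum_lt`; `linWeight ≥ 0`). [cite: Balaban1985BackgroundPropagators, (3.100) p.413] -/
theorem sum_sum_abs_readout_eq {y : Zd P.d} (hy : y ∈ box z₀ (R₀ : ℤ)) :
    ∑ μ : Fin P.d, ∑ ν : Fin P.d, |wt y μ ν| =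
      2 * ∑ q : {q : Fin P.d × Fin P.d // q.1 < q.2}, linWeight j a ⟨castSite y, q.1.1, q.1.2, q.2⟩ := by
  have habs : ∀ μ ν, |wt y μ ν| = wt y μ ν * (if μ < ν then (1 : ℝ) else if ν < μ then -1 else 0) := by
    intro μ ν
    rcases lt_trichotomy μ ν with h | h | h
    · rw [if_pos h, mul_one, readout_of_lt a z₀ R₀ wt hwt hy h, abs_of_nonneg (linWeight_nonneg j a _)]
    · subst h; rw [readout_diag a z₀ R₀ wt hwt]; simp
    · rw [if_neg (not_lt.2 h.le), if_pos h, readout_of_gt a z₀ R₀ wt hwt hy h, abs_neg, abs_of_nonneg (linWeight_nonneg j a _)]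
      ring
  simp only [habs]
  rw [sum_sum_eq_two_mul_sum_lt (wt y) (fun μ ν => if μ < ν then (1 : ℝ) else if ν < μ then -1 else 0)
    (readout_antisymm a z₀ R₀ wt hwt y) (sign_antisymm)]
  congr 1
  refine Finset.sum_congr rfl fun q _ => ?_
  rw [if_pos q.2, mul_one, readout_of_lt a z₀ R₀ wt hwt hy q.2]

include hwt in
/-- ★ **`Σ_μΣ_ν wt y μ ν² = 2·Σ_{μ<ν} (linWeight j a ⟨castSite y, μ, ν⟩)²`** at a chart point. [cite: Balaban1985BackgroundPropagators, (3.100) p.413] -/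
theorem sum_sum_sq_readout_eq {y : Zd P.d} (hy : y ∈ box z₀ (R₀ : ℤ)) :
    ∑ μ : Fin P.d, ∑ ν : Fin P.d, wt y μ ν ^ 2 =
      2 * ∑ q : {q : Fin P.d × Fin P.d // q.1 < q.2}, linWeight j a ⟨castSite y, q.1.1, q.1.2, q.2⟩ ^ 2 := by
  simp only [sq]
  rw [sum_sum_eq_two_mul_sum_lt (wt y) (wt y) (readout_antisymm a z₀ R₀ wt hwt y) (readout_antisymm a z₀ R₀ wt hwt y)]
  congr 1
  refine Finset.sum_congr rfl fun q _ => ?_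
  rw [readout_of_lt a z₀ R₀ wt hwt hy q.2]

/-! ## §3 The chart box injects into the torus plaquettes -/

/-- ★ **A `μ<ν`-box sum is a sub-sum of the plaquette sum**: for `G ≥ 0` and the chart box NON-WRAPPING (`2R₀ < sitesPerDir 0`),
`Σ_{y∈Q_{R₀}(z₀)} Σ_{μ<ν} G ⟨castSite y, μ, ν⟩ ≤ Σ_{p : Plaq P 0} G p` (✓`castSite_injOn_box`). [folklore] -/
theorem sum_box_lt_le_sum_plaq (hR₀ : 2 * (R₀ : ℤ) < P.sitesPerDir 0) (G : Plaq P 0 → ℝ) (hG : ∀ p, 0 ≤ G p) :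
    ∑ y ∈ box z₀ (R₀ : ℤ), ∑ q : {q : Fin P.d × Fin P.d // q.1 < q.2}, G ⟨castSite y, q.1.1, q.1.2, q.2⟩ ≤ ∑ p : Plaq P 0, G p := by
  classical
  -- the chart box as `Π_i [z₀_i − R₀, z₀_i + R₀]`
  have hN : ∀ κ, (fun i => z₀ i + R₀) κ - (fun i => z₀ i - R₀) κ < P.sitesPerDir 0 := fun κ => by simp only; linarith [hR₀]
  have mem_iff : ∀ y : Zd P.d, y ∈ box z₀ (R₀ : ℤ) ↔ (fun i => z₀ i - R₀) ≤ y ∧ y ≤ (fun i => z₀ i + R₀) := by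
    intro y
    rw [mem_box]
    constructor
    · intro h
      exact ⟨fun i => by have := h i; rw [abs_le] at this; simp only; linarith,
        fun i => by have := h i; rw [abs_le] at this; simp only; linarith⟩
    · intro h i
      have h1 := h.1 i; have h2 := h.2 i
      simp only at h1 h2
      rw [abs_le]; constructor <;> linarith
  let mk : (Zd P.d) × {q : Fin P.d × Fin P.d // q.1 < q.2} → Plaq P 0 := fun t => ⟨castSite t.1, t.2.1.1, t.2.1.2, t.2.2⟩
  have hinj : ∀ t ∈ box z₀ (R₀ : ℤ) ×ˢ (Finset.univ : Finset {q : Fin P.d × Fin P.d // q.1 < q.2}),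
      ∀ t' ∈ box z₀ (R₀ : ℤ) ×ˢ (Finset.univ : Finset {q : Fin P.d × Fin P.d // q.1 < q.2}), mk t = mk t' → t = t' := by
    intro t ht t' ht' h
    have h1 : (castSite t.1 : Site P 0) = castSite t'.1 := congrArg Plaq.src h
    have h2 : t.2.1.1 = t'.2.1.1 := congrArg Plaq.μ h
    have h3 : t.2.1.2 = t'.2.1.2 := congrArg Plaq.ν h
    have ht1 := (mem_iff t.1).1 (Finset.mem_product.1 ht).1
    have ht1' := (mem_iff t'.1).1 (Finset.mem_product.1 ht').1
    exact Prod.ext (castSite_injOn_box hN ht1.1 ht1.2 ht1'.1 ht1'.2 h1) (Subtype.ext (Prod.ext h2 h3))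
  rw [← Finset.sum_product (box z₀ (R₀ : ℤ)) Finset.univ (fun t => G (mk t)), ← Finset.sum_image hinj]
  exact Finset.sum_le_sum_of_subset_of_nonneg (Finset.subset_univ _) fun p _ _ => hG p

/-! ## §4 The two STEP-0 rows -/

include hwt in
/-- ★★★ **`M₀ ≤ 2·(L·L)^j`**: `Σ_μ Σ_ν' Σ_{y∈Q_{R₀}(z₀)} |wt y μ ν'| ≤ 2·Σ_p linWeight j a p = 2·(L·L)^j` (KNIT-D's `M₀` letter; chart box non-wrapping).
[cite: Balaban1987RG1, (0.1)/(0.3) pp.251-252] -/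
theorem readout_abs_sum_le (hR₀ : 2 * (R₀ : ℤ) < P.sitesPerDir 0) :
    ∑ μ : Fin P.d, ∑ ν' : Fin P.d, ∑ y ∈ box z₀ (R₀ : ℤ), |wt y μ ν'| ≤ 2 * ((P.L : ℝ) * P.L) ^ j := by
  have hcomm : ∑ μ : Fin P.d, ∑ ν' : Fin P.d, ∑ y ∈ box z₀ (R₀ : ℤ), |wt y μ ν'| =
      ∑ y ∈ box z₀ (R₀ : ℤ), ∑ μ : Fin P.d, ∑ ν' : Fin P.d, |wt y μ ν'| := by
    calc ∑ μ : Fin P.d, ∑ ν' : Fin P.d, ∑ y ∈ box z₀ (R₀ : ℤ), |wt y μ ν'|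
        = ∑ μ : Fin P.d, ∑ y ∈ box z₀ (R₀ : ℤ), ∑ ν' : Fin P.d, |wt y μ ν'| :=
          Finset.sum_congr rfl fun μ _ => Finset.sum_comm
      _ = ∑ y ∈ box z₀ (R₀ : ℤ), ∑ μ : Fin P.d, ∑ ν' : Fin P.d, |wt y μ ν'| := Finset.sum_comm
  rw [hcomm, Finset.sum_congr rfl fun y hy => sum_sum_abs_readout_eq a z₀ R₀ wt hwt hy, ← Finset.mul_sum _ _ (2 : ℝ),
    ← sum_linWeight j a]
  exact mul_le_mul_of_nonneg_left (sum_box_lt_le_sum_plaq z₀ R₀ hR₀ (linWeight j a) (linWeight_nonneg j a)) (by norm_num)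

include hwt in
/-- ★★★ **`Σ_{Q_{R₀}(z₀)} Σ_μ Σ_ν wt² ≤ 2·(L²∕L^d)^j·(L²)^j`** (KNIT-D's energy-row letter; ✓`sum_linWeight_sq_le`, `j ≤ m + K`).
[cite: Balaban1987RG1, (0.1)/(0.3) pp.251-252] [cite: Balaban1985Averaging, (48) p.26] -/
theorem readout_sq_sum_le (hR₀ : 2 * (R₀ : ℤ) < P.sitesPerDir 0) (hj : j ≤ P.m + P.K) :
    ∑ y ∈ box z₀ (R₀ : ℤ), ∑ μ : Fin P.d, ∑ ν : Fin P.d, wt y μ ν ^ 2 ≤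
      2 * (((P.L : ℝ) * P.L * (((P.L : ℝ) ^ P.d)⁻¹)) ^ j * ((P.L : ℝ) * P.L) ^ j) := by
  rw [Finset.sum_congr rfl fun y hy => sum_sum_sq_readout_eq a z₀ R₀ wt hwt hy, ← Finset.mul_sum _ _ (2 : ℝ)]
  refine mul_le_mul_of_nonneg_left ?_ (by norm_num)
  exact (sum_box_lt_le_sum_plaq z₀ R₀ hR₀ (fun p => linWeight j a p ^ 2) (fun p => sq_nonneg _)).trans (sum_linWeight_sq_le hj a)

end Summit.QuantumFields.YangMills.Theorems.GrossTransferStubLinTestWeightReadoutRows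

end
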